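import Literature.MathematicalPhysics.QuantumLattice.HubbardWindowCertificateAffine
import HarnessLib

/-!
# Ventures/CertifiedManyBodySolver — Rows/RingCeiling.lean

HONEST FRAMING: first certified bounds; not a superconductivity verdict; every number certified or labelled float.

THE RING CEILING, LEAN SIDE (lead D-18 r70 typing ask `ringCeiling`; cal-1 `HOME/cal/RING-CEILING.md` §1, refereed ref-1 R1.13;
LEAN-MAP §1.8). The cell's structural verdict on window-local relaxation ladders is: a thermodynamic-limit window certificate whose
words are supported in a window `Λ'` is FEASIBLE at every sufficiently long finite ring, hence it cannot certify above the ring's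
ground-state energy per site. For PERIODIC rings and for the constraint families of the tree's certificate identity (Gram/PSD blocks,
equation-of-motion commutators with the window-local Hamiltonian, affine symmetry rows `x ↦ εx + v`, charged ladder words, anti-Hermitian
rows, density multipliers) this is NOT a new fact: it is the finite-ring statement from which the tree derives the TL transport,
`Literature.MathematicalPhysics.QuantumLattice.hubbardChain_energyPerSite_ge_of_window_certificate` (HubbardWindowCertificateAffine.lean;
Han 2020 §2). This file only NAMES it in the cell's vocabulary with the two hypotheses of RING-CEILING.md §1 made explicit:

* H1 (support): the window `Λ'` has coordinate spread `≤ M` (`hM`) and the ring length satisfies `L ≥ M + 3` (`hL`) — then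
  `x ↦ x mod L` is injective on the 1-thickening of `Λ'` (`injOn_proj_thicken_one_of_spread`) and the identity transports to the ring
  `hubbardChain L = fermionTorusGraph 1 L` (periodic boundary condition);
* H2 (state): NOT NEEDED here — the tree proof evaluates the identity in the symmetry-AVERAGED state of an arbitrary ground state of the
  `2·nh`-particle sector, so no uniqueness (Lieb 1989) and no closed-shell condition enter; every `L ≥ M + 3` and every sector qualify.

Printed precedent for the LTI/spin/PBC special case: Kull–Schuch–Dive–Navascués, PRX 14, 021008 (2024) §6.2 ('the LTI energy density
E_LTI(n) is thus upper bounded by the smallest ground state energy density for any ring of size m ≥ n'). [cite: KullEtAl2024, §6.2]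
What is NOT covered by these theorems (paper lemma only, RING-CEILING.md §1 / R1.13): anti-periodic closed shells (no flux ring in the
transport), KKT blocks (K0/K±) and LTI marginal cones — they are not terms of the tree's certificate identity. The numerical ceilings
`cap_gap(L)` are cal-1's certified ring table (`cal/ring_ceiling.json`), reference values, not tree objects. The 2-D analogue for `L×L` periodic
tori (t′ allowed) is `groundEnergy_hubbardTorusTT'_div_ge_of_window_certificate(_d4)` (HubbardNNNHoppingWindowCertificate(D4).lean).
-/

noncomputable section

namespace Summit.Ventures.CertifiedManyBodySolver.Rows

open Matrix Finset
open Literature.MathematicalPhysics.QuantumLattice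
open Literature.MathematicalPhysics.QuantumLattice.HubbardWave0
open Literature.Probability.LatticeModels
open Literature.MathematicalPhysics.QuantumManyBody.StateRelaxation
open scoped ComplexOrder BigOperators

variable {L : ℕ} [NeZero L]

/-- **Ring ceiling, periodic rings (RING-CEILING.md §1, PBC part; D-18 r70).** A chain window certificate in the tree's identity shape
(`hcert`, the hypothesis list of `hubbardChain_energyPerSite_ge_of_window_certificate` verbatim) whose window `Λ'` has coordinate spread
`≤ M` (H1) is feasible at EVERY periodic ring of length `L ≥ M + 3` and every particle number `2·nh ≤ 2L`:
`c − Σₖ ‖aₖ‖ + (Σ_σ μ_σ)·(nh/L − ν) ≤ E₀(ring L, 2·nh)/L`. No uniqueness / closed-shell hypothesis (H2) is used.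
[cite: Han2020Bootstrap, §2] for the identity ⇒ bound step; [cite: KullEtAl2024, §6.2] for the printed LTI/PBC remark. -/
theorem ringCeiling_chain (t U : ℝ) {M : ℕ} {nh : ℕ} (hn : nh ≤ L)
    {Λ Λ' : Finset (Site 1)} (hΛ : Λ ⊆ Λ')
    (hM : ∀ x ∈ Λ', ∀ y ∈ Λ', ∀ j, |x j - y j| ≤ (M : ℤ)) (hL : M + 3 ≤ L)
    (hclosed : ∀ x ∈ Λ, ∀ i : Fin 1, x + unitVec i ∈ Λ' ∧ x - unitVec i ∈ Λ')
    (h0 : thicken ({0} : Finset (Site 1)) 1 ⊆ Λ') (hz : (0 : Site 1) ∈ Λ')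
    (μ : Fin 2 → ℝ) (ν : ℝ)
    {m : Type*} [Fintype m] [DecidableEq m] {Λm : Matrix m m ℂ} (hΛm : Λm.PosSemidef)
    (O : m → FermionOp Λ')
    {κ : Type*} (s : Finset κ) (B : κ → FermionOp Λ)
    {ι : Type*} (tt : Finset ι) (ε : ι → ℤˣ) (v : ι → Site 1) (hsh : ∀ l, affShiftSet (ε l) (v l) Λ ⊆ Λ')
    (Y : ι → FermionOp Λ)
    {γ : Type*} (u : Finset γ) (b : γ → ℂ) (cw : γ → List (Orb (PolySite Λ') × Bool))
    (hcw : ∀ j ∈ u, ladderCharge (cw j) ≠ 0 ∨ ladderSpinCharge (cw j) ≠ 0)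
    {δ : Type*} (ah : Finset δ) (dc : δ → ℝ) (V : δ → FermionOp Λ')
    {κ'' : Type*} (w : Finset κ'') (a : κ'' → ℂ) (word : κ'' → List (Orb (PolySite Λ') × Bool)) {c : ℝ}
    (hcert : fermionEmbed (PolySite.incl h0) ((hubbardFermionInteraction 1 t U).meanEnergyObs 1) -
        (c : ℂ) • (1 : FermionOp Λ') -
        ∑ σ : Fin 2, ((μ σ : ℝ) : ℂ) • (nAt 0 hz σ - ((ν : ℝ) : ℂ) • (1 : FermionOp Λ')) =
      gramForm Λm O +
        (∑ k ∈ s, ((hubbardFermionInteraction 1 t U).localHamiltonian Λ' * fermionEmbed (PolySite.incl hΛ) (B k) -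
            fermionEmbed (PolySite.incl hΛ) (B k) * (hubbardFermionInteraction 1 t U).localHamiltonian Λ') +
          ∑ l ∈ tt, (fermionEmbed (PolySite.incl (hsh l)) (fermionEmbed (PolySite.affEmb (ε l) (v l) Λ) (Y l)) -
            fermionEmbed (PolySite.incl hΛ) (Y l)) +
          ∑ j ∈ u, b j • ladderWord (cw j)) +
        (∑ m' ∈ ah, ((dc m' : ℝ) : ℂ) • ((V m')ᴴ - V m') + ∑ k ∈ w, a k • ladderWord (word k))) :
    c - ∑ k ∈ w, ‖a k‖ + (∑ σ : Fin 2, μ σ) * ((nh : ℝ) / (L : ℝ) - ν) ≤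
      energyPerSite (hubbardChain L) t U (2 * nh) :=
  hubbardChain_energyPerSite_ge_of_window_certificate t U (le_trans (Nat.le_add_left 3 M) hL) hn hΛ hclosed h0 hz
    (injOn_proj_thicken_one_of_spread hM hL) μ ν hΛm O s B tt ε v hsh Y u b cw hcw ah dc V w a word hcert

/-- **Ring ceiling at half filling, even periodic rings** (the shape of the cell's `M1EnergyLowerRow` certificates: density rows
`n_{0σ} − ½·1`, so the multiplier term vanishes at `N = L`): `c − Σₖ ‖aₖ‖ ≤ E₀(ring L, N = L)/L` for every even `L ≥ M + 3`.
[cite: Han2020Bootstrap, §2] -/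
theorem ringCeiling_chain_halfFilled (t U : ℝ) {M : ℕ} (hLe : Even L)
    {Λ Λ' : Finset (Site 1)} (hΛ : Λ ⊆ Λ')
    (hM : ∀ x ∈ Λ', ∀ y ∈ Λ', ∀ j, |x j - y j| ≤ (M : ℤ)) (hL : M + 3 ≤ L)
    (hclosed : ∀ x ∈ Λ, ∀ i : Fin 1, x + unitVec i ∈ Λ' ∧ x - unitVec i ∈ Λ')
    (h0 : thicken ({0} : Finset (Site 1)) 1 ⊆ Λ') (hz : (0 : Site 1) ∈ Λ')
    (μ : Fin 2 → ℝ)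
    {m : Type*} [Fintype m] [DecidableEq m] {Λm : Matrix m m ℂ} (hΛm : Λm.PosSemidef)
    (O : m → FermionOp Λ')
    {κ : Type*} (s : Finset κ) (B : κ → FermionOp Λ)
    {ι : Type*} (tt : Finset ι) (ε : ι → ℤˣ) (v : ι → Site 1) (hsh : ∀ l, affShiftSet (ε l) (v l) Λ ⊆ Λ')
    (Y : ι → FermionOp Λ)
    {γ : Type*} (u : Finset γ) (b : γ → ℂ) (cw : γ → List (Orb (PolySite Λ') × Bool))
    (hcw : ∀ j ∈ u, ladderCharge (cw j) ≠ 0 ∨ ladderSpinCharge (cw j) ≠ 0)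
    {δ : Type*} (ah : Finset δ) (dc : δ → ℝ) (V : δ → FermionOp Λ')
    {κ'' : Type*} (w : Finset κ'') (a : κ'' → ℂ) (word : κ'' → List (Orb (PolySite Λ') × Bool)) {c : ℝ}
    (hcert : fermionEmbed (PolySite.incl h0) ((hubbardFermionInteraction 1 t U).meanEnergyObs 1) -
        (c : ℂ) • (1 : FermionOp Λ') -
        ∑ σ : Fin 2, ((μ σ : ℝ) : ℂ) • (nAt 0 hz σ - ((1 / 2 : ℝ) : ℂ) • (1 : FermionOp Λ')) =
      gramForm Λm O +
        (∑ k ∈ s, ((hubbardFermionInteraction 1 t U).localHamiltonian Λ' * fermionEmbed (PolySite.incl hΛ) (B k) -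
            fermionEmbed (PolySite.incl hΛ) (B k) * (hubbardFermionInteraction 1 t U).localHamiltonian Λ') +
          ∑ l ∈ tt, (fermionEmbed (PolySite.incl (hsh l)) (fermionEmbed (PolySite.affEmb (ε l) (v l) Λ) (Y l)) -
            fermionEmbed (PolySite.incl hΛ) (Y l)) +
          ∑ j ∈ u, b j • ladderWord (cw j)) +
        (∑ m' ∈ ah, ((dc m' : ℝ) : ℂ) • ((V m')ᴴ - V m') + ∑ k ∈ w, a k • ladderWord (word k))) :
    c - ∑ k ∈ w, ‖a k‖ ≤ groundEnergyAt (fermionTorusGraph 1 L) t U L / (L : ℝ) :=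
  hubbardChain_groundEnergyAt_div_ge_of_window_certificate t U (le_trans (Nat.le_add_left 3 M) hL) hLe hΛ hclosed h0 hz
    (injOn_proj_thicken_one_of_spread hM hL) μ hΛm O s B tt ε v hsh Y u b cw hcw ah dc V w a word hcert

/-- **The ceiling as used by the cell (RING-CEILING.md §0 'E ≤ E₀(L)/L', D-18 r70).** If a ring energy per site is itself CERTIFIED from
above, `E₀(ring L, N = L)/L ≤ r` (cal-1's Krawczyk-certified finite-`L` Lieb–Wu table supplies such `r`; here a hypothesis `hr`), then NO
half-filling chain window certificate of spread `≤ M ≤ L − 3` certifies a value above `r`: `c − Σₖ ‖aₖ‖ ≤ r`. -/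
theorem ringCeiling_chain_halfFilled_le (t U : ℝ) {M : ℕ} (hLe : Even L) {r : ℝ}
    (hr : groundEnergyAt (fermionTorusGraph 1 L) t U L / (L : ℝ) ≤ r)
    {Λ Λ' : Finset (Site 1)} (hΛ : Λ ⊆ Λ')
    (hM : ∀ x ∈ Λ', ∀ y ∈ Λ', ∀ j, |x j - y j| ≤ (M : ℤ)) (hL : M + 3 ≤ L)
    (hclosed : ∀ x ∈ Λ, ∀ i : Fin 1, x + unitVec i ∈ Λ' ∧ x - unitVec i ∈ Λ')
    (h0 : thicken ({0} : Finset (Site 1)) 1 ⊆ Λ') (hz : (0 : Site 1) ∈ Λ')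
    (μ : Fin 2 → ℝ)
    {m : Type*} [Fintype m] [DecidableEq m] {Λm : Matrix m m ℂ} (hΛm : Λm.PosSemidef)
    (O : m → FermionOp Λ')
    {κ : Type*} (s : Finset κ) (B : κ → FermionOp Λ)
    {ι : Type*} (tt : Finset ι) (ε : ι → ℤˣ) (v : ι → Site 1) (hsh : ∀ l, affShiftSet (ε l) (v l) Λ ⊆ Λ')
    (Y : ι → FermionOp Λ)
    {γ : Type*} (u : Finset γ) (b : γ → ℂ) (cw : γ → List (Orb (PolySite Λ') × Bool))
    (hcw : ∀ j ∈ u, ladderCharge (cw j) ≠ 0 ∨ ladderSpinCharge (cw j) ≠ 0)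
    {δ : Type*} (ah : Finset δ) (dc : δ → ℝ) (V : δ → FermionOp Λ')
    {κ'' : Type*} (w : Finset κ'') (a : κ'' → ℂ) (word : κ'' → List (Orb (PolySite Λ') × Bool)) {c : ℝ}
    (hcert : fermionEmbed (PolySite.incl h0) ((hubbardFermionInteraction 1 t U).meanEnergyObs 1) -
        (c : ℂ) • (1 : FermionOp Λ') -
        ∑ σ : Fin 2, ((μ σ : ℝ) : ℂ) • (nAt 0 hz σ - ((1 / 2 : ℝ) : ℂ) • (1 : FermionOp Λ')) =
      gramForm Λm O +
        (∑ k ∈ s, ((hubbardFermionInteraction 1 t U).localHamiltonian Λ' * fermionEmbed (PolySite.incl hΛ) (B k) -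
            fermionEmbed (PolySite.incl hΛ) (B k) * (hubbardFermionInteraction 1 t U).localHamiltonian Λ') +
          ∑ l ∈ tt, (fermionEmbed (PolySite.incl (hsh l)) (fermionEmbed (PolySite.affEmb (ε l) (v l) Λ) (Y l)) -
            fermionEmbed (PolySite.incl hΛ) (Y l)) +
          ∑ j ∈ u, b j • ladderWord (cw j)) +
        (∑ m' ∈ ah, ((dc m' : ℝ) : ℂ) • ((V m')ᴴ - V m') + ∑ k ∈ w, a k • ladderWord (word k))) :
    c - ∑ k ∈ w, ‖a k‖ ≤ r :=
  le_trans (ringCeiling_chain_halfFilled t U hLe hΛ hM hL hclosed h0 hz μ hΛm O s B tt ε v hsh Y u b cw hcw ah dc V w a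
    word hcert) hr

end Summit.Ventures.CertifiedManyBodySolver.Rows
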